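import Literature.AlgebraicGeometry.Frobenioids.Thm34Sub
import Literature.AlgebraicGeometry.Frobenioids.PerfectionFunctorialityUnique
import HarnessLib

/-!
# Frobenioids I, Theorem 3.4 sub-DAG: closers of `Thm34Sub` slots, tranche 5 — slot (iii)/L01p,
# `1`-uniqueness of the perfection square for `C₁` of perfect type

Mochizuki, *The geometry of Frobenioids I: the general theory*, Kyushu J. Math. **62** (2008),
Thm. 3.4 (iii) p. 62 l. 42 – p. 63 l. 2 ("there exists a 1-unique functor `Ψ^pf : C₁^pf → C₂^pf` that fits
into a 1-commutative diagram"), proof p. 64 ll. 26–28 [cite: MochizukiFrdI2008, Thm. 3.4 (iii) p.62].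

PROOF-ONLY file (abc-iut-w4-d033, sub-DAG `plan/L1/SUBDAG-FrdI-Thm34.md`, row `FrdI:Thm3.4(iii)/L01p`
perfect-type uniqueness; tranche 5 of the `Thm34Sub` closers, a NEW file next to abc-iut-L1-d8's tranches 1–3
`Thm34SubClosers{,2,3}.lean` and abc-iut-w4-d088's tranche 4 `Thm34SubClosers4.lean`, all left untouched).
It closes the LAST open slot of `Thm34Sub.lean` (abc-iut-L1-d8, p412196),
`FrdI.Thm34Sub.L01p_PfSquareUnique_ofPerfect`, by abc-iut-L1-d1's
`PreFrobenioid.Perfection.oneUniqueSquare_map_of_isOfPerfectType` (`PerfectionFunctorialityUnique.lean`,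
p412414): for Frobenioids `C₁ → F_{Φ₁}`, `C₂ → F_{Φ₂}`, an equivalence `Ψ : C₁ ≌ C₂` compatible with arrows of
Frobenius type, and `C₁` of perfect type, the functor `Ψ^pf := Perfection.map` makes the square with the
natural functors `C_i → C_i^pf` a `OneUniqueSquare` (it is an equivalence, the square `1`-commutes, and any
other functor fitting the square is isomorphic to it — `C₁ → C₁^pf` being an equivalence, Prop. 3.2 (iii)).
Nothing is restated; no statement of the paper is strengthened; the general (non-perfect) bare `1`-uniqueness
conjunct stays the GAP-LEDGER residual G-L1d8-2 (not a named fact, not assumed here).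
-/

namespace Literature.AlgebraicGeometry.Frobenioids

namespace FrdI

namespace Thm34Sub

open CategoryTheory PreFrobenioidData

universe w v v' u u'

variable {D₁ : Type u} [Category.{v} D₁] {Φ₁ : D₁ᵒᵖ ⥤ CommMonCat.{w}} {C₁ : Type u'} [Category.{v'} C₁]
  {D₂ : Type u} [Category.{v} D₂] {Φ₂ : D₂ᵒᵖ ⥤ CommMonCat.{w}} {C₂ : Type u'} [Category.{v'} C₂]
  (F₁ : C₁ ⥤ ElemFrobenioid Φ₁) (F₂ : C₂ ⥤ ElemFrobenioid Φ₂) (Ψ : C₁ ≌ C₂)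

/-- **SLOT (iii)/L01p `PfSquareUnique_ofPerfect` — CLOSED**: for Frobenioids `C₁ → F_{Φ₁}`, `C₂ → F_{Φ₂}`,
an equivalence `Ψ : C₁ ≌ C₂` compatible with arrows of Frobenius type, and `C₁` of perfect type, there is a
functor `Ψ^pf : C₁^pf → C₂^pf` (namely `PreFrobenioid.Perfection.map`) forming a `1`-unique `1`-commutative
square with the natural functors `C_i → C_i^pf` (abc-iut-L1-d1
`PreFrobenioid.Perfection.oneUniqueSquare_map_of_isOfPerfectType`, p412414).
[cite: MochizukiFrdI2008, Thm. 3.4 (iii) p.62] -/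
theorem l01p_pfSquareUnique_ofPerfect_holds :
    Literature.AlgebraicGeometry.Frobenioids.FrdI.Thm34Sub.L01p_PfSquareUnique_ofPerfect F₁ F₂ Ψ :=
  fun hF₁ hF₂ hΨ hP₁ =>
    ⟨PreFrobenioid.Perfection.map (hF₁ := hF₁) (hF₂ := hF₂) hΨ,
      PreFrobenioid.Perfection.oneUniqueSquare_map_of_isOfPerfectType (hF₁ := hF₁) (hF₂ := hF₂) hP₁ Ψ hΨ⟩

end Thm34Sub

end FrdI

end Literature.AlgebraicGeometry.Frobenioids
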